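import Literature.NumberTheory.LFunctions.GaussianHeckeZeroDensity
import Literature.NumberTheory.LFunctions.GaussianHeckeVKRegion
import Literature.NumberTheory.LFunctions.GaussianHeckeColemanZFR
import Literature.NumberTheory.LFunctions.GaussianPrimesHarmanProofs
import HarnessLib

/-!
# Kubilius' zero-free region for `L(s, Ξ_k)` from a Vinogradov–Korobov (Coleman) region: the glue

Topic `Literature/NumberTheory/LFunctions`, proofs for the named fact
`GaussianHecke.kubilius_zeroFreeRegion` of `GaussianHeckeZeroDensity.lean`
([HuangLiuRudnick2020, Thm. 2] = J. Kubilius 1955: for `k ≥ 1`, `V = √((T+2)² + (2k)²)`, every zero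
`ρ = β + iγ` of `L(s, Ξ_k)` with `|γ| < T` has `1 - β ≫ (log V · log log V)^{-3/4}`).
Everything in this file is PROVED; no definitions, no named facts.

* `GaussianHecke.kubilius_zeroFreeRegion_of_vk` — **Kubilius' region from any region of
  Vinogradov–Korobov shape** `GaussianHecke.HasVKZeroFreeRegion c V₀` (`c > 0`; the predicate of
  `GaussianHeckeVKRegion.lean`, i.e. the shape of M. D. Coleman's Theorem 2 (Mathematika 37 (1990))
  for `K = ℚ(i)`): the width `c/((log V')^{2/3}(log log V')^{1/3})`, `V' = k + |γ| + 3 ≤ 2V`, exceeds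
  `c/(log V · log log V)^{3/4}` as soon as `log V ≥ 4096` (`vkDen_le_kubDen`), and in the bounded
  range `V < e^{4096}` or `V' < V₀` (finitely many `k`, bounded `|γ|`) the finitely many entire
  functions `D_k` have a common zero-free strip `Re s ≥ 1 - δ₀` (`GaussianHecke.exists_width_of_le`,
  from the non-vanishing on `Re s = 1`), while the Kubilius width is at most `c_K / D_min`,
  `D_min = (log √8 · log log √8)^{3/4} > 0` (`V ≥ √8 > e`).  So `c_K = min(c, δ₀ D_min)` works.

* `GaussianHecke.kubilius_zeroFreeRegion_of_latticeExpSumBound` — hence **Kubilius' region from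
  the lattice exponential-sum hypothesis** `GaussianHecke.LatticeExpSumBound C D` (`C ≥ 0`, `D > 0`;
  the shape of Coleman's Theorem 1 for `ℚ(i)`), through the tree's Landau–Titchmarsh deduction
  `GaussianHecke.exists_hasVKZeroFreeRegion_of_latticeExpSumBound` (`GaussianHeckeColemanZFR.lean`).

* `GaussianHecke.kubilius_zeroFreeRegion_holds` — **the DISCHARGE** `kubilius_zeroFreeRegion`, unconditionally:
  the exponential-sum input `∃ C ≥ 0, D > 0, LatticeExpSumBound C D` is the tree's theorem
  `GaussianHecke.exists_latticeExpSumBound` (`GaussianPrimesHarmanProofs.lean`, Part B: Coleman's Theorem 1 for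
  `ℚ(i)`, conductor `1`, by Vinogradov's method on the lines `Im z = b` of `ℤ[i]`).

Thus the named fact is reduced to `∃ c > 0, ∃ V₀, HasVKZeroFreeRegion c V₀` (Coleman 1990, Thm 2 for
`ℚ(i)`), exactly the hypothesis through which every other consumer in the tree is fed
(`GaussianPrimesHarmanProofs.lean`), and further to the single exponential-sum input
`LatticeExpSumBound C D` (Coleman 1990, Thm 1 for `ℚ(i)`), which the tree proves; so the fact HOLDS.

## References

* B. Huang, J. Liu, Z. Rudnick, *Gaussian primes in almost all narrow sectors*, Acta Arith. 193
  (2020), Theorem 2 (= J. Kubilius, Vilniaus Valst. Univ. Mokslo Darbai 4 (1955)). [HuangLiuRudnick2020]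
* M. D. Coleman, *A zero-free region for the Hecke L-functions*, Mathematika 37 (1990), 287–304,
  Theorem 2. [ColemanMathematika1990]
-/

noncomputable section

open Complex Filter Topology

namespace Literature.NumberTheory.LFunctions

namespace GaussianHecke

/-! ### Elementary inequalities for `V = √((T+2)² + (2k)²)` -/

/-- `e < √8` (`e² < 7.39 < 8`). [folklore] -/
theorem exp_one_lt_sqrt_eight : Real.exp 1 < Real.sqrt 8 := by
  rw [Real.lt_sqrt (Real.exp_pos 1).le]
  have := Real.exp_one_lt_d9
  nlinarith [Real.exp_pos 1]

/-- `√8 ≤ V` for `k ≥ 1`, `T ≥ 0`. [folklore] -/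
theorem sqrt_eight_le_kubiliusV {k : ℕ} (hk : 1 ≤ k) {T : ℝ} (hT : 0 ≤ T) :
    Real.sqrt 8 ≤ kubiliusV k T := by
  have h8 := eight_le_kubiliusV_sq hk hT
  have hV : 0 ≤ kubiliusV k T := le_trans (by norm_num) (two_le_kubiliusV k hT)
  calc Real.sqrt 8 ≤ Real.sqrt (kubiliusV k T ^ 2) := Real.sqrt_le_sqrt h8
    _ = kubiliusV k T := Real.sqrt_sq hV

/-- `T + 2 ≤ V`. [folklore] -/
theorem add_two_le_kubiliusV (k : ℕ) {T : ℝ} (hT : 0 ≤ T) : T + 2 ≤ kubiliusV k T := by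
  unfold kubiliusV
  rw [Real.le_sqrt (by linarith) (by positivity)]
  nlinarith [sq_nonneg (2 * (k : ℝ))]

/-- `2k ≤ V`. [folklore] -/
theorem two_mul_le_kubiliusV (k : ℕ) {T : ℝ} (hT : 0 ≤ T) : 2 * (k : ℝ) ≤ kubiliusV k T := by
  unfold kubiliusV
  rw [Real.le_sqrt (by positivity) (by positivity)]
  nlinarith [sq_nonneg (T + 2)]

/-! ### The two denominators -/

/-- Kubilius' denominator `(log V · log log V)^{3/4}` is positive for `V > e`. [folklore] -/
theorem kubDen_pos {V : ℝ} (hV : Real.exp 1 < V) :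
    0 < (Real.log V * Real.log (Real.log V)) ^ (3 / 4 : ℝ) := by
  have h0 : 0 < V := (Real.exp_pos 1).trans hV
  have h1 : 1 < Real.log V := by rw [Real.lt_log_iff_exp_lt h0]; exact hV
  have h2 : 0 < Real.log (Real.log V) := Real.log_pos h1
  exact Real.rpow_pos_of_pos (mul_pos (by linarith) h2) _

/-- Kubilius' denominator is monotone in `V > e`. [folklore] -/
theorem kubDen_mono {V V' : ℝ} (hV : Real.exp 1 < V) (hVV' : V ≤ V') :
    (Real.log V * Real.log (Real.log V)) ^ (3 / 4 : ℝ) ≤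
      (Real.log V' * Real.log (Real.log V')) ^ (3 / 4 : ℝ) := by
  have h0 : 0 < V := (Real.exp_pos 1).trans hV
  have h1 : 1 < Real.log V := by rw [Real.lt_log_iff_exp_lt h0]; exact hV
  have hlog : Real.log V ≤ Real.log V' := Real.log_le_log h0 hVV'
  have h2 : 0 < Real.log (Real.log V) := Real.log_pos h1
  have hll : Real.log (Real.log V) ≤ Real.log (Real.log V') := Real.log_le_log (by linarith) hlog
  refine Real.rpow_le_rpow (by positivity) ?_ (by norm_num)
  exact mul_le_mul hlog hll h2.le (by linarith)

/-- **The Vinogradov–Korobov width beats Kubilius' width for large `V`**: for `x ≥ 4096` and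
`1 < x' ≤ 2x`, `x'^{2/3} (log x')^{1/3} ≤ (x log x)^{3/4}` (apply with `x = log V`, `x' = log V'`,
`V' ≤ 2V`): indeed `x'^{2/3}(log x')^{1/3} ≤ (2x)^{2/3}(2 log x)^{1/3} = 2 x^{2/3}(log x)^{1/3}` and
`x^{1/12}(log x)^{5/12} ≥ 4096^{1/12} = 2`. [folklore] -/
theorem vkDen_le_kubDen {x x' : ℝ} (hx : 4096 ≤ x) (hx'1 : 1 < x') (hx' : x' ≤ 2 * x) :
    x' ^ (2 / 3 : ℝ) * Real.log x' ^ (1 / 3 : ℝ) ≤ (x * Real.log x) ^ (3 / 4 : ℝ) := by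
  have hx0 : 0 < x := by linarith
  have hx'0 : 0 < x' := by linarith
  have hlog2 : Real.log 2 ≤ 1 := by have := Real.log_two_lt_d9; linarith
  have hlogx : 2 ≤ Real.log x := by
    rw [Real.le_log_iff_exp_le hx0]
    have h1 := Real.exp_one_lt_d9
    have h : Real.exp 2 = Real.exp 1 * Real.exp 1 := by rw [← Real.exp_add]; norm_num
    nlinarith [Real.exp_pos 1]
  have hlxpos : 0 < Real.log x := by linarith
  have hlogx' : Real.log x' ≤ 2 * Real.log x := by
    calc Real.log x' ≤ Real.log (2 * x) := Real.log_le_log hx'0 hx'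
      _ = Real.log 2 + Real.log x := Real.log_mul (by norm_num) hx0.ne'
      _ ≤ 2 * Real.log x := by linarith
  have hlx'pos : 0 < Real.log x' := Real.log_pos hx'1
  -- upper bounds for the two factors on the left
  have hA : x' ^ (2 / 3 : ℝ) ≤ (2 : ℝ) ^ (2 / 3 : ℝ) * x ^ (2 / 3 : ℝ) := by
    rw [← Real.mul_rpow (by norm_num) hx0.le]
    exact Real.rpow_le_rpow hx'0.le hx' (by norm_num)
  have hB : Real.log x' ^ (1 / 3 : ℝ) ≤ (2 : ℝ) ^ (1 / 3 : ℝ) * Real.log x ^ (1 / 3 : ℝ) := by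
    rw [← Real.mul_rpow (by norm_num) hlxpos.le]
    exact Real.rpow_le_rpow hlx'pos.le hlogx' (by norm_num)
  have h22 : (2 : ℝ) ^ (2 / 3 : ℝ) * (2 : ℝ) ^ (1 / 3 : ℝ) = 2 := by
    rw [← Real.rpow_add (by norm_num)]; norm_num
  -- lower bounds for the two extra factors on the right
  have hC : (2 : ℝ) ≤ x ^ (1 / 12 : ℝ) := by
    have h4096 : (4096 : ℝ) ^ (1 / 12 : ℝ) = 2 := by
      rw [show (4096 : ℝ) = (2 : ℝ) ^ (12 : ℝ) by norm_num, ← Real.rpow_mul (by norm_num)]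
      norm_num
    rw [← h4096]
    exact Real.rpow_le_rpow (by norm_num) hx (by norm_num)
  have hD : (1 : ℝ) ≤ Real.log x ^ (5 / 12 : ℝ) := Real.one_le_rpow (by linarith) (by norm_num)
  have hCD : (2 : ℝ) ≤ x ^ (1 / 12 : ℝ) * Real.log x ^ (5 / 12 : ℝ) := by
    calc (2 : ℝ) = 2 * 1 := by ring
      _ ≤ x ^ (1 / 12 : ℝ) * Real.log x ^ (5 / 12 : ℝ) :=
        mul_le_mul hC hD (by norm_num) (Real.rpow_nonneg hx0.le _)
  -- splitting the right side
  have e1 : x ^ (3 / 4 : ℝ) = x ^ (2 / 3 : ℝ) * x ^ (1 / 12 : ℝ) := by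
    rw [← Real.rpow_add hx0]; norm_num
  have e2 : Real.log x ^ (3 / 4 : ℝ) = Real.log x ^ (1 / 3 : ℝ) * Real.log x ^ (5 / 12 : ℝ) := by
    rw [← Real.rpow_add hlxpos]; norm_num
  have hR : (x * Real.log x) ^ (3 / 4 : ℝ) =
      (x ^ (1 / 12 : ℝ) * Real.log x ^ (5 / 12 : ℝ)) * (x ^ (2 / 3 : ℝ) * Real.log x ^ (1 / 3 : ℝ)) := by
    rw [Real.mul_rpow hx0.le hlxpos.le, e1, e2]; ring
  calc x' ^ (2 / 3 : ℝ) * Real.log x' ^ (1 / 3 : ℝ)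
      ≤ ((2 : ℝ) ^ (2 / 3 : ℝ) * x ^ (2 / 3 : ℝ)) * ((2 : ℝ) ^ (1 / 3 : ℝ) * Real.log x ^ (1 / 3 : ℝ)) :=
        mul_le_mul hA hB (Real.rpow_nonneg hlx'pos.le _) (by positivity)
    _ = 2 * (x ^ (2 / 3 : ℝ) * Real.log x ^ (1 / 3 : ℝ)) := by rw [mul_mul_mul_comm, h22]
    _ ≤ (x ^ (1 / 12 : ℝ) * Real.log x ^ (5 / 12 : ℝ)) * (x ^ (2 / 3 : ℝ) * Real.log x ^ (1 / 3 : ℝ)) :=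
        mul_le_mul_of_nonneg_right hCD (by positivity)
    _ = (x * Real.log x) ^ (3 / 4 : ℝ) := hR.symm

/-! ### Kubilius' region from a Vinogradov–Korobov region -/

/-- **Kubilius' zero-free region [HuangLiuRudnick2020, Thm. 2] from any region of Vinogradov–Korobov
shape** `HasVKZeroFreeRegion c V₀`, `c > 0` (the shape of Coleman 1990, Theorem 2, for `K = ℚ(i)`):
for `V ≥ e^{4096}` and `V' = k + |Im ρ| + 3 ≥ V₀` the Vinogradov–Korobov width at `V' ≤ 2V` is the
larger (`vkDen_le_kubDen`); the bounded range is a common zero-free strip of finitely many `D_k`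
(`exists_width_of_le`). [cite: HuangLiuRudnick2020, Thm. 2 (Kubilius 1955)]
[cite: ColemanMathematika1990, Theorem 2] -/
theorem kubilius_zeroFreeRegion_of_vk {c V₀ : ℝ} (hc : 0 < c) (hVK : HasVKZeroFreeRegion c V₀) :
    kubilius_zeroFreeRegion := by
  set V₃ : ℝ := max V₀ (Real.exp 4096) with hV₃
  obtain ⟨δ₀, hδ₀, hsmall⟩ := exists_width_of_le V₃
  set Dmin : ℝ := (Real.log (Real.sqrt 8) * Real.log (Real.log (Real.sqrt 8))) ^ (3 / 4 : ℝ)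
    with hDmin
  have hDmin_pos : 0 < Dmin := kubDen_pos exp_one_lt_sqrt_eight
  refine ⟨min c (δ₀ * Dmin), lt_min hc (mul_pos hδ₀ hDmin_pos), ?_⟩
  intro k hk T hT ρ hρ hγ
  set V := kubiliusV k T with hVdef
  have hk1 : (1 : ℝ) ≤ k := by exact_mod_cast hk
  have hV8 : Real.sqrt 8 ≤ V := sqrt_eight_le_kubiliusV hk hT
  have hVe : Real.exp 1 < V := exp_one_lt_sqrt_eight.trans_le hV8
  have hV2 : 2 ≤ V := two_le_kubiliusV k hT
  have hTV : T + 2 ≤ V := add_two_le_kubiliusV k hT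
  have hkV : 2 * (k : ℝ) ≤ V := two_mul_le_kubiliusV k hT
  have hDV : Dmin ≤ (Real.log V * Real.log (Real.log V)) ^ (3 / 4 : ℝ) :=
    kubDen_mono exp_one_lt_sqrt_eight hV8
  have hDVpos : 0 < (Real.log V * Real.log (Real.log V)) ^ (3 / 4 : ℝ) := kubDen_pos hVe
  -- the Vinogradov–Korobov parameter `V' = k + |γ| + 3 ≤ 2V`
  set V' : ℝ := (k : ℝ) + |ρ.im| + 3 with hV'def
  have hV'V : V' ≤ 2 * V := by rw [hV'def]; linarith
  have hV'4 : (4 : ℝ) ≤ V' := by rw [hV'def]; linarith [abs_nonneg ρ.im]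
  have hV'e : Real.exp 1 < V' := by have := Real.exp_one_lt_d9; linarith
  by_cases hbig : V₀ ≤ V' ∧ Real.exp 4096 ≤ V
  · -- the Vinogradov–Korobov range
    obtain ⟨hV₀, hVexp⟩ := hbig
    have hlt : ρ.re < 1 - c / (Real.log V' ^ (2 / 3 : ℝ) * Real.log (Real.log V') ^ (1 / 3 : ℝ)) := by
      by_contra hge
      push Not at hge
      exact hVK k ρ hk hV₀ hge hρ
    have hx : 4096 ≤ Real.log V := by
      rw [Real.le_log_iff_exp_le (by linarith)]; exact hVexp
    have hx'1 : 1 < Real.log V' := by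
      rw [Real.lt_log_iff_exp_lt (by linarith)]; exact hV'e
    have hx' : Real.log V' ≤ 2 * Real.log V := by
      calc Real.log V' ≤ Real.log (2 * V) := Real.log_le_log (by linarith) hV'V
        _ = Real.log 2 + Real.log V := Real.log_mul (by norm_num) (by linarith)
        _ ≤ 2 * Real.log V := by have := Real.log_two_lt_d9; linarith
    have hden : Real.log V' ^ (2 / 3 : ℝ) * Real.log (Real.log V') ^ (1 / 3 : ℝ) ≤
        (Real.log V * Real.log (Real.log V)) ^ (3 / 4 : ℝ) := vkDen_le_kubDen hx hx'1 hx'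
    have hdenpos : 0 < Real.log V' ^ (2 / 3 : ℝ) * Real.log (Real.log V') ^ (1 / 3 : ℝ) :=
      vkDen_pos hV'e
    calc min c (δ₀ * Dmin) / (Real.log V * Real.log (Real.log V)) ^ (3 / 4 : ℝ)
        ≤ c / (Real.log V * Real.log (Real.log V)) ^ (3 / 4 : ℝ) :=
          div_le_div_of_nonneg_right (min_le_left _ _) hDVpos.le
      _ ≤ c / (Real.log V' ^ (2 / 3 : ℝ) * Real.log (Real.log V') ^ (1 / 3 : ℝ)) :=
          div_le_div_of_nonneg_left hc.le hdenpos hden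
      _ ≤ 1 - ρ.re := by linarith
  · -- the bounded range: `k ≤ V₃`, `|γ| ≤ V₃`
    have hbd : (k : ℝ) ≤ V₃ ∧ |ρ.im| ≤ V₃ := by
      rcases not_and_or.mp hbig with h | h
      · push Not at h
        have h1 : V₀ ≤ V₃ := le_max_left _ _
        constructor <;> [skip; skip] <;> linarith [abs_nonneg ρ.im]
      · push Not at h
        have h1 : Real.exp 4096 ≤ V₃ := le_max_right _ _
        constructor <;> linarith [abs_nonneg ρ.im]
    have hlt : ρ.re < 1 - δ₀ := by
      by_contra hge
      push Not at hge
      exact hsmall k hk hbd.1 ρ hbd.2 hge hρ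
    calc min c (δ₀ * Dmin) / (Real.log V * Real.log (Real.log V)) ^ (3 / 4 : ℝ)
        ≤ δ₀ * Dmin / (Real.log V * Real.log (Real.log V)) ^ (3 / 4 : ℝ) :=
          div_le_div_of_nonneg_right (min_le_right _ _) hDVpos.le
      _ ≤ δ₀ * Dmin / Dmin := div_le_div_of_nonneg_left (by positivity) hDmin_pos hDV
      _ = δ₀ := by field_simp
      _ ≤ 1 - ρ.re := by linarith

/-- **Kubilius' zero-free region [HuangLiuRudnick2020, Thm. 2] from the lattice exponential-sum
hypothesis** `LatticeExpSumBound C D` (`C ≥ 0`, `D > 0`; Coleman 1990, Theorem 1 for `ℚ(i)` in Ford's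
normalisation): Theorem 1 ⟹ Richert-type bound ⟹ Coleman's region
(`exists_hasVKZeroFreeRegion_of_latticeExpSumBound`) ⟹ Kubilius' region (`kubilius_zeroFreeRegion_of_vk`).
[cite: HuangLiuRudnick2020, Thm. 2 (Kubilius 1955)] [cite: ColemanMathematika1990, Theorems 1–2] -/
theorem kubilius_zeroFreeRegion_of_latticeExpSumBound {C D : ℝ} (h : LatticeExpSumBound C D)
    (hC : 0 ≤ C) (hD : 0 < D) : kubilius_zeroFreeRegion := by
  obtain ⟨c, hc, hVK⟩ := exists_hasVKZeroFreeRegion_of_latticeExpSumBound h hC hD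
  exact kubilius_zeroFreeRegion_of_vk hc hVK

/-! ### The discharge -/

/-- **Kubilius' zero-free region for the Hecke `L`-functions `L(s, Ξ_k)` of `ℚ(i)` HOLDS**
[HuangLiuRudnick2020, Thm. 2 = J. Kubilius 1955]: there is an absolute `c > 0` such that for `k ≥ 1`, `T ≥ 0`
and every zero `ρ = β + iγ` of `D_k = 4L(·, Ξ_k)` with `|γ| < T`, `1 − β ≥ c/(log V · log log V)^{3/4}`,
`V = √((T+2)² + (2k)²)`.  Proof: the tree's unconditional Vinogradov estimate for the lattice sums
`GaussianHecke.exists_latticeExpSumBound` (Coleman 1990, Theorem 1 for `ℚ(i)`) fed into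
`kubilius_zeroFreeRegion_of_latticeExpSumBound` (Theorem 1 ⟹ Richert-type bound ⟹ Coleman's
Vinogradov–Korobov region ⟹ Kubilius' weaker region). [cite: HuangLiuRudnick2020, Thm. 2 (Kubilius 1955)]
[cite: ColemanMathematika1990, Theorems 1–2] -/
theorem kubilius_zeroFreeRegion_holds : kubilius_zeroFreeRegion := by
  obtain ⟨C, D, hC, hD, h⟩ := exists_latticeExpSumBound
  exact kubilius_zeroFreeRegion_of_latticeExpSumBound h hC hD

end GaussianHecke

end Literature.NumberTheory.LFunctions

end
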